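import Mathlib
import Summits.ValiantsHypothesis.ValiantsHypothesis.Theorems.GrenetZeonTwoDimCoefficientsDualUnipotentStaircaseGeneral
import Summits.ValiantsHypothesis.ValiantsHypothesis.Theorems.GrenetZeonTwoDimCoefficientsDualUnipotentLayeredPaths

/-!
# Crux `GrenetZeon.TwoDimCoefficients` (stmt-ValiantsHypothesis-8062) / rung `DualUnipotentThreeHalves`
# (stmt-ValiantsHypothesis-24318): (H) ON THE LAYERED FAMILY — the ROW-BLOCK THEOREM (upper family)

Port of note `HESSIAN-RATE-LAYERED.md` §3/§8 (this seat), over ✓ `…StaircaseGeneral` (p825302) and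
✓ `…LayeredPaths` (p825235/p825403).  Setting (ambient `M_ι(K)`, level function `lvl ≤ d`, level projectors
`D ℓ = diag[lvl = ℓ]`, levelled point `A` (`A a b ≠ 0 → lvl b = lvl a + 1`), corner weight `E`
(`E a b ≠ 0 → lvl a = d ∧ lvl b = 0`), path matrix `P = Σ_{k≤d} A^k`, `Q = P·E·P`).  By (★) of the note the
Hessian of `per_n` at the point, on pencil directions `U, U'`, is `tr(U·P·U'·Q) + tr(U·Q·U'·P)`, and its
`i`-th row block (directions `U` at edge level `i`) is read off from `D_{i+1}·(P·U'·Q + Q·U'·P)·D_i`; with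
`U' = Σ_j D_j·U'·D_{j+1}` (✓ `levelled_eq_sum_proj_mul_mul_proj`) the FIRST summand is spanned by the sandwiches
`M¹_j·X'·O¹_j`, `M¹_j = D_{i+1}·P·D_j`, `O¹_j = D_{j+1}·Q·D_i`.

* ★ `finrank_span_upperRowBlock_le` — **for every edge level `i < d` and EVERY level `ℓ⋆ ≤ d`, the span of all
  `M¹_j·X'·O¹_j` (`j < d`, `X'` arbitrary) has dimension `≤ #{lvl = ℓ⋆}·(#{lvl = i+1} + #{lvl = i})`.**
  Proof = the staircase (✓ `finrank_span_mul_mul_le_of_antitone_monotone_of_le`) on the chains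
  `R_j = colsp(D_{i+1}·A^{j−i−1})` (antitone) and `C_j = rowsp(A^{d−(j+1)}·E·A^i·D_i)` (monotone; `= O¹_j` by the
  closed forms ✓ `proj_mul_pathSum_mul_corner`, ✓ `corner_mul_pathSum_mul_proj`), the small side being the one
  whose path passes level `ℓ⋆` (✓ `proj_mul_pow_add`).
The lower family (`Q·U'·P`) is the mirror image and the sum over `i` gives `rank Hess ≤ 4·t·m`, (H) with `C = 4`
on the layered family — NOT assembled in this file (note §8; honest: this is one of the two row-block theorems).

HONEST FRAMING: def-free matrix algebra; layered ⊂ triangularisable where 3/2 is already known by flats; no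
stub, rung or crux is closed; `DualUnipotentBound`, 24318, (c), `VP ≠ VNP` NOT proved.
-/

-- single-conjunct layout `Summits/ValiantsHypothesis/ValiantsHypothesis`: the duplicated namespace
-- component is mandated by the tree.
set_option linter.dupNamespace false

noncomputable section

namespace Summit.ValiantsHypothesis.ValiantsHypothesis.Cruxes.TwoDimCoefficients.DimTwoCases

open Matrix

variable {K : Type*} [Field K] {ι : Type*} [Fintype ι] [DecidableEq ι]

/-! ### Small range / rank helpers -/

omit [DecidableEq ι] in
/-- A column of `G·H` lies in the column space of `G`. [folklore] -/
theorem col_mul_mem_range_mulVecLin (G H : Matrix ι ι K) (c : ι) :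
    (fun a => (G * H) a c) ∈ LinearMap.range G.mulVecLin := by
  refine ⟨fun x => H x c, ?_⟩
  ext a
  simp [Matrix.mulVec, dotProduct, Matrix.mul_apply]

/-- A row of `G` lies in the row space of `G` (= column space of `Gᵀ`). [folklore] -/
theorem row_mem_range_mulVecLin_transpose (G : Matrix ι ι K) (e : ι) :
    (fun b => G e b) ∈ LinearMap.range Gᵀ.mulVecLin := by
  refine ⟨Pi.single e 1, ?_⟩
  ext b
  simp

omit [DecidableEq ι] in
/-- Column spaces shrink under right multiplication (`mulVecLin` form). [folklore] -/
theorem range_mulVecLin_mul_le (G H : Matrix ι ι K) :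
    LinearMap.range (G * H).mulVecLin ≤ LinearMap.range G.mulVecLin := by
  rw [Matrix.mulVecLin_mul]
  exact LinearMap.range_comp_le_range _ _

omit [DecidableEq ι] in
/-- The column space of a matrix has dimension its rank (definition of `Matrix.rank`). [folklore] -/
theorem finrank_range_mulVecLin (G : Matrix ι ι K) :
    Module.finrank K (LinearMap.range G.mulVecLin) = G.rank := rfl

omit [DecidableEq ι] in
/-- `rank (Z₁ · D · Z₂) ≤ rank D`. [folklore] -/
theorem rank_mul_mul_le_mid (Z₁ Dm Z₂ : Matrix ι ι K) : (Z₁ * Dm * Z₂).rank ≤ Dm.rank :=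
  (Matrix.rank_mul_le_left _ _).trans (Matrix.rank_mul_le_right _ _)

/-! ### The upper row block -/

/-- **ROW-BLOCK THEOREM (upper family).**  See the module docstring.  `i` is the edge level of the row
block (`i + 1 ≤ d`), `ℓ⋆ ≤ d` ANY level (the bound is sharpest at the thinnest one). [folklore] -/
theorem finrank_span_upperRowBlock_le (lvl : ι → ℕ) (D : ℕ → Matrix ι ι K)
    (hD : ∀ ℓ, D ℓ = Matrix.diagonal fun a => if lvl a = ℓ then (1 : K) else 0)
    {d : ℕ} (A E : Matrix ι ι K)
    (hA : ∀ a b, A a b ≠ 0 → lvl b = lvl a + 1) (hE : ∀ a b, E a b ≠ 0 → lvl a = d ∧ lvl b = 0)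
    {i ℓs : ℕ} (hi : i + 1 ≤ d) (hℓs : ℓs ≤ d) :
    Module.finrank K (Submodule.span K {Z : Matrix ι ι K | ∃ j : Fin d, ∃ X' : Matrix ι ι K,
        Z = (D (i + 1) * (∑ k ∈ Finset.range (d + 1), A ^ k) * D j) * X' *
              (D (j + 1) * ((∑ k ∈ Finset.range (d + 1), A ^ k) * E *
                (∑ k ∈ Finset.range (d + 1), A ^ k)) * D i)}) ≤
      Fintype.card {a // lvl a = ℓs} *
        (Fintype.card {a // lvl a = i + 1} + Fintype.card {a // lvl a = i}) := by
  set P : Matrix ι ι K := ∑ k ∈ Finset.range (d + 1), A ^ k with hP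
  have hcomm := levelProj_comm lvl D hD A hA
  -- closed forms of the two factors
  have hM : ∀ j : Fin d, i + 1 ≤ (j : ℕ) →
      D (i + 1) * P * D j = D (i + 1) * A ^ ((j : ℕ) - i - 1) * D j := by
    intro j hij
    rw [hP, proj_mul_pathSum_mul_proj_of_le lvl D hD A hA hij (by omega),
      show (j : ℕ) - i - 1 = (j : ℕ) - (i + 1) by omega, intertwine_pow D A hcomm,
      show i + 1 + ((j : ℕ) - (i + 1)) = (j : ℕ) by omega, Matrix.mul_assoc,
      levelProj_mul_self lvl D hD]
  have hM0 : ∀ j : Fin d, (j : ℕ) < i + 1 → D (i + 1) * P * D j = 0 := fun j hji => by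
    rw [hP]; exact proj_mul_pathSum_mul_proj_of_lt lvl D hD A hA hji
  have hO : ∀ j : Fin d, D ((j : ℕ) + 1) * (P * E * P) * D i =
      A ^ (d - ((j : ℕ) + 1)) * E * A ^ i * D i := by
    intro j
    have h1 : D ((j : ℕ) + 1) * P * E = A ^ (d - ((j : ℕ) + 1)) * E := by
      rw [hP]; exact proj_mul_pathSum_mul_corner lvl D hD A E hA hE (by omega)
    have h2 : E * P * D i = E * A ^ i * D i := by
      rw [hP]; exact corner_mul_pathSum_mul_proj lvl D hD A E hA hE (by omega)
    calc D ((j : ℕ) + 1) * (P * E * P) * D i = (D ((j : ℕ) + 1) * P * E) * (P * D i) := by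
          simp only [Matrix.mul_assoc]
      _ = A ^ (d - ((j : ℕ) + 1)) * (E * P * D i) := by rw [h1]; simp only [Matrix.mul_assoc]
      _ = A ^ (d - ((j : ℕ) + 1)) * E * A ^ i * D i := by rw [h2]; simp only [Matrix.mul_assoc]
  -- the chains
  let R : Fin d → Submodule K (ι → K) := fun j =>
    LinearMap.range (D (i + 1) * A ^ ((j : ℕ) - i - 1)).mulVecLin
  let C : Fin d → Submodule K (ι → K) := fun j =>
    LinearMap.range (A ^ (d - ((j : ℕ) + 1)) * E * A ^ i * D i)ᵀ.mulVecLin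
  have hRanti : Antitone R := by
    intro j j' hjj'
    obtain ⟨e, he⟩ := Nat.exists_eq_add_of_le (show (j : ℕ) - i - 1 ≤ (j' : ℕ) - i - 1 by
      have : (j : ℕ) ≤ j' := hjj'; omega)
    show LinearMap.range _ ≤ LinearMap.range _
    rw [he, pow_add, ← Matrix.mul_assoc]
    exact range_mulVecLin_mul_le _ _
  have hCmono : Monotone C := by
    intro j j' hjj'
    have hj' : (j' : ℕ) < d := j'.isLt
    obtain ⟨e, he⟩ := Nat.exists_eq_add_of_le (show d - ((j' : ℕ) + 1) ≤ d - ((j : ℕ) + 1) by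
      have : (j : ℕ) ≤ j' := hjj'; omega)
    show LinearMap.range _ ≤ LinearMap.range _
    rw [he, add_comm, pow_add]
    simp only [Matrix.mul_assoc]
    rw [Matrix.transpose_mul (A ^ e)]
    exact range_mulVecLin_mul_le _ _
  have hRX : ∀ j, R j ≤ LinearMap.range (D (i + 1)).mulVecLin := fun j => range_mulVecLin_mul_le _ _
  have hCY : ∀ j, C j ≤ LinearMap.range (D i)ᵀ.mulVecLin := by
    intro j
    show LinearMap.range _ ≤ LinearMap.range _
    rw [Matrix.transpose_mul]
    exact range_mulVecLin_mul_le _ _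
  -- generators lie in the chains
  have hMmem : ∀ (j : Fin d) (c : ι), (fun a => (D (i + 1) * P * D j) a c) ∈ R j := by
    intro j c
    by_cases hij : i + 1 ≤ (j : ℕ)
    · rw [hM j hij]; exact col_mul_mem_range_mulVecLin _ _ c
    · rw [hM0 j (by omega)]
      have h0 : (fun a => (0 : Matrix ι ι K) a c) = 0 := by ext; simp
      rw [h0]; exact (R j).zero_mem
  have hOmem : ∀ (j : Fin d) (e : ι), (fun b => (D ((j : ℕ) + 1) * (P * E * P) * D i) e b) ∈ C j := by
    intro j e
    rw [hO j]; exact row_mem_range_mulVecLin_transpose _ e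
  -- one side is small at every index
  have hrankD : (D ℓs).rank = Fintype.card {a // lvl a = ℓs} := by
    rw [hD]; exact rank_diagonal_level lvl ℓs
  have ht : ∀ j, Module.finrank K (R j) ≤ Fintype.card {a // lvl a = ℓs} ∨
      Module.finrank K (C j) ≤ Fintype.card {a // lvl a = ℓs} := by
    intro j
    rw [← hrankD]
    by_cases h1 : i + 1 ≤ ℓs ∧ ℓs ≤ (j : ℕ)
    · left
      show Module.finrank K (LinearMap.range (Matrix.mulVecLin _)) ≤ _
      rw [finrank_range_mulVecLin,
        show (j : ℕ) - i - 1 = (ℓs - i - 1) + ((j : ℕ) - ℓs) by omega,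
        proj_mul_pow_add D A hcomm, show i + 1 + (ℓs - i - 1) = ℓs by omega]
      exact (Matrix.rank_mul_le_left _ _).trans (Matrix.rank_mul_le_right _ _)
    · right
      show Module.finrank K (LinearMap.range (Matrix.mulVecLin _)) ≤ _
      rw [finrank_range_mulVecLin, Matrix.rank_transpose]
      by_cases h2 : ℓs ≤ i
      · -- the arriving path `E·A^i·D_i` passes level `ℓs`
        have hE0 : E * D 0 = E := by rw [corner_mul_levelProj lvl D hD E hE 0, if_pos rfl]
        have hpow : A ^ i = A ^ (ℓs + (i - ℓs)) := by rw [show ℓs + (i - ℓs) = i by omega]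
        have hfac : E * A ^ i * D i = E * (A ^ ℓs * D ℓs * A ^ (i - ℓs)) * D i := by
          conv_lhs => rw [hpow, ← hE0, Matrix.mul_assoc E (D 0),
            proj_mul_pow_add D A hcomm 0 ℓs (i - ℓs), zero_add]
        have : A ^ (d - ((j : ℕ) + 1)) * E * A ^ i * D i =
            (A ^ (d - ((j : ℕ) + 1)) * E * A ^ ℓs) * D ℓs * (A ^ (i - ℓs) * D i) := by
          rw [Matrix.mul_assoc (A ^ (d - ((j : ℕ) + 1))) E (A ^ i),
            Matrix.mul_assoc (A ^ (d - ((j : ℕ) + 1))) (E * A ^ i) (D i), hfac]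
          simp only [Matrix.mul_assoc]
        rw [this]
        exact rank_mul_mul_le_mid _ _ _
      · -- the leaving path `A^{d-(j+1)}·E` from level `j+1` passes level `ℓs`
        have hDd : D d * E = E := by rw [levelProj_mul_corner lvl D hD E hE d, if_pos rfl]
        have key : ∀ n : ℕ, (j : ℕ) + 1 + ((ℓs - ((j : ℕ) + 1)) + (d - ℓs)) = n →
            A ^ ((ℓs - ((j : ℕ) + 1)) + (d - ℓs)) * D n =
              A ^ (ℓs - ((j : ℕ) + 1)) * D ℓs * A ^ (d - ℓs) := by
          intro n hn
          subst hn
          rw [← intertwine_pow D A hcomm, proj_mul_pow_add D A hcomm,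
            show (j : ℕ) + 1 + (ℓs - ((j : ℕ) + 1)) = ℓs by omega]
        have : A ^ (d - ((j : ℕ) + 1)) * E * A ^ i * D i =
            A ^ (ℓs - ((j : ℕ) + 1)) * D ℓs * (A ^ (d - ℓs) * E * A ^ i * D i) := by
          conv_lhs => rw [← hDd, show d - ((j : ℕ) + 1) = (ℓs - ((j : ℕ) + 1)) + (d - ℓs) by omega]
          calc A ^ (ℓs - ((j : ℕ) + 1) + (d - ℓs)) * (D d * E) * A ^ i * D i
              = (A ^ (ℓs - ((j : ℕ) + 1) + (d - ℓs)) * D d) * E * A ^ i * D i := by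
                simp only [Matrix.mul_assoc]
            _ = A ^ (ℓs - ((j : ℕ) + 1)) * D ℓs * (A ^ (d - ℓs) * E * A ^ i * D i) := by
                rw [key d (by omega)]; simp only [Matrix.mul_assoc]
        rw [this]
        exact rank_mul_mul_le_mid _ _ _
  -- receiving spaces
  have hX : Module.finrank K (LinearMap.range (D (i + 1)).mulVecLin) = Fintype.card {a // lvl a = i + 1} := by
    rw [finrank_range_mulVecLin, hD]; exact rank_diagonal_level lvl (i + 1)
  have hY : Module.finrank K (LinearMap.range (D i)ᵀ.mulVecLin) = Fintype.card {a // lvl a = i} := by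
    rw [finrank_range_mulVecLin, Matrix.rank_transpose, hD]; exact rank_diagonal_level lvl i
  have main := finrank_span_mul_mul_le_of_antitone_monotone_of_le
    (κ := fun _ : Fin d => ι) (μ := fun _ : Fin d => ι)
    (fun j : Fin d => D (i + 1) * P * D j) (fun j : Fin d => D ((j : ℕ) + 1) * (P * E * P) * D i)
    R C (LinearMap.range (D (i + 1)).mulVecLin) (LinearMap.range (D i)ᵀ.mulVecLin)
    hRX hCY hRanti hCmono hMmem hOmem ht
  rw [hX, hY] at main
  exact main

/-! ### The lower row block (family `Q·U'·P`) -/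

/-- **ROW-BLOCK THEOREM (lower family).**  Same setting; the sandwiches are now
`(D_{i+1}·Q·D_j)·X'·(D_{j+1}·P·D_i)` (the `j < i` blocks of the Hessian row `i`), and the bound is the same
`#{lvl = ℓ⋆}·(#{lvl = i+1} + #{lvl = i})` for EVERY level `ℓ⋆ ≤ d`. [folklore] -/
theorem finrank_span_lowerRowBlock_le (lvl : ι → ℕ) (D : ℕ → Matrix ι ι K)
    (hD : ∀ ℓ, D ℓ = Matrix.diagonal fun a => if lvl a = ℓ then (1 : K) else 0)
    {d : ℕ} (A E : Matrix ι ι K)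
    (hA : ∀ a b, A a b ≠ 0 → lvl b = lvl a + 1) (hE : ∀ a b, E a b ≠ 0 → lvl a = d ∧ lvl b = 0)
    {i ℓs : ℕ} (hi : i + 1 ≤ d) (hℓs : ℓs ≤ d) :
    Module.finrank K (Submodule.span K {Z : Matrix ι ι K | ∃ j : Fin d, ∃ X' : Matrix ι ι K,
        Z = (D (i + 1) * ((∑ k ∈ Finset.range (d + 1), A ^ k) * E *
                (∑ k ∈ Finset.range (d + 1), A ^ k)) * D j) * X' *
              (D (j + 1) * (∑ k ∈ Finset.range (d + 1), A ^ k) * D i)}) ≤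
      Fintype.card {a // lvl a = ℓs} *
        (Fintype.card {a // lvl a = i + 1} + Fintype.card {a // lvl a = i}) := by
  set P : Matrix ι ι K := ∑ k ∈ Finset.range (d + 1), A ^ k with hP
  have hcomm := levelProj_comm lvl D hD A hA
  -- closed forms
  have hM : ∀ j : Fin d, D (i + 1) * (P * E * P) * D j = A ^ (d - (i + 1)) * E * A ^ (j : ℕ) * D j := by
    intro j
    have h1 : D (i + 1) * P * E = A ^ (d - (i + 1)) * E := by
      rw [hP]; exact proj_mul_pathSum_mul_corner lvl D hD A E hA hE hi
    have h2 : E * P * D j = E * A ^ (j : ℕ) * D j := by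
      rw [hP]; exact corner_mul_pathSum_mul_proj lvl D hD A E hA hE (by omega)
    calc D (i + 1) * (P * E * P) * D j = (D (i + 1) * P * E) * (P * D j) := by
          simp only [Matrix.mul_assoc]
      _ = A ^ (d - (i + 1)) * (E * P * D j) := by rw [h1]; simp only [Matrix.mul_assoc]
      _ = A ^ (d - (i + 1)) * E * A ^ (j : ℕ) * D j := by rw [h2]; simp only [Matrix.mul_assoc]
  have hO : ∀ j : Fin d, (j : ℕ) + 1 ≤ i →
      D ((j : ℕ) + 1) * P * D i = A ^ (i - ((j : ℕ) + 1)) * D i := by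
    intro j hji
    rw [hP]; exact proj_mul_pathSum_mul_proj_of_le lvl D hD A hA hji (by omega)
  have hO0 : ∀ j : Fin d, i < (j : ℕ) + 1 → D ((j : ℕ) + 1) * P * D i = 0 := fun j hij => by
    rw [hP]; exact proj_mul_pathSum_mul_proj_of_lt lvl D hD A hA hij
  -- the chains
  let R : Fin d → Submodule K (ι → K) := fun j =>
    LinearMap.range (A ^ (d - (i + 1)) * E * A ^ (j : ℕ)).mulVecLin
  let C : Fin d → Submodule K (ι → K) := fun j =>
    LinearMap.range (A ^ (i - ((j : ℕ) + 1)) * D i)ᵀ.mulVecLin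
  have hRanti : Antitone R := by
    intro j j' hjj'
    obtain ⟨e, he⟩ := Nat.exists_eq_add_of_le (show (j : ℕ) ≤ (j' : ℕ) from hjj')
    show LinearMap.range _ ≤ LinearMap.range _
    rw [he, pow_add, ← Matrix.mul_assoc]
    exact range_mulVecLin_mul_le _ _
  have hCmono : Monotone C := by
    intro j j' hjj'
    obtain ⟨e, he⟩ := Nat.exists_eq_add_of_le (show i - ((j' : ℕ) + 1) ≤ i - ((j : ℕ) + 1) by
      have : (j : ℕ) ≤ j' := hjj'; omega)
    show LinearMap.range _ ≤ LinearMap.range _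
    rw [he, add_comm, pow_add, Matrix.mul_assoc, Matrix.transpose_mul (A ^ e)]
    exact range_mulVecLin_mul_le _ _
  have hPE : A ^ (d - (i + 1)) * E = D (i + 1) * (P * E) := by
    rw [← Matrix.mul_assoc, hP]; exact (proj_mul_pathSum_mul_corner lvl D hD A E hA hE hi).symm
  have hRX : ∀ j, R j ≤ LinearMap.range (D (i + 1)).mulVecLin := by
    intro j
    show LinearMap.range _ ≤ LinearMap.range _
    rw [hPE, Matrix.mul_assoc]
    exact range_mulVecLin_mul_le _ _
  have hCY : ∀ j, C j ≤ LinearMap.range (D i)ᵀ.mulVecLin := by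
    intro j
    show LinearMap.range _ ≤ LinearMap.range _
    rw [Matrix.transpose_mul]
    exact range_mulVecLin_mul_le _ _
  -- generators lie in the chains
  have hMmem : ∀ (j : Fin d) (c : ι), (fun a => (D (i + 1) * (P * E * P) * D j) a c) ∈ R j := by
    intro j c
    rw [hM j]; exact col_mul_mem_range_mulVecLin _ _ c
  have hOmem : ∀ (j : Fin d) (e : ι), (fun b => (D ((j : ℕ) + 1) * P * D i) e b) ∈ C j := by
    intro j e
    by_cases hji : (j : ℕ) + 1 ≤ i
    · rw [hO j hji]; exact row_mem_range_mulVecLin_transpose _ e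
    · rw [hO0 j (by omega)]
      have h0 : (fun b => (0 : Matrix ι ι K) e b) = 0 := by ext; simp
      rw [h0]; exact (C j).zero_mem
  -- one side is small at every index
  have hrankD : (D ℓs).rank = Fintype.card {a // lvl a = ℓs} := by
    rw [hD]; exact rank_diagonal_level lvl ℓs
  have ht : ∀ j, Module.finrank K (R j) ≤ Fintype.card {a // lvl a = ℓs} ∨
      Module.finrank K (C j) ≤ Fintype.card {a // lvl a = ℓs} := by
    intro j
    rw [← hrankD]
    by_cases h1 : (j : ℕ) + 1 ≤ ℓs ∧ ℓs ≤ i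
    · right
      show Module.finrank K (LinearMap.range (Matrix.mulVecLin _)) ≤ _
      have key : ∀ n : ℕ, (j : ℕ) + 1 + ((ℓs - ((j : ℕ) + 1)) + (i - ℓs)) = n →
          A ^ ((ℓs - ((j : ℕ) + 1)) + (i - ℓs)) * D n =
            A ^ (ℓs - ((j : ℕ) + 1)) * D ℓs * A ^ (i - ℓs) := by
        intro n hn
        subst hn
        rw [← intertwine_pow D A hcomm, proj_mul_pow_add D A hcomm,
          show (j : ℕ) + 1 + (ℓs - ((j : ℕ) + 1)) = ℓs by omega]
      rw [finrank_range_mulVecLin, Matrix.rank_transpose,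
        show i - ((j : ℕ) + 1) = (ℓs - ((j : ℕ) + 1)) + (i - ℓs) by omega, key i (by omega)]
      exact rank_mul_mul_le_mid _ _ _
    · left
      show Module.finrank K (LinearMap.range (Matrix.mulVecLin _)) ≤ _
      rw [finrank_range_mulVecLin]
      by_cases h2 : ℓs ≤ (j : ℕ)
      · -- the arriving path `E·A^j` passes level `ℓs`
        have hE0 : E * D 0 = E := by rw [corner_mul_levelProj lvl D hD E hE 0, if_pos rfl]
        have hpow : A ^ (j : ℕ) = A ^ (ℓs + ((j : ℕ) - ℓs)) := by
          rw [show ℓs + ((j : ℕ) - ℓs) = (j : ℕ) by omega]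
        have hfac : E * A ^ (j : ℕ) = E * (A ^ ℓs * D ℓs * A ^ ((j : ℕ) - ℓs)) := by
          conv_lhs => rw [hpow, ← hE0, Matrix.mul_assoc E (D 0),
            proj_mul_pow_add D A hcomm 0 ℓs ((j : ℕ) - ℓs), zero_add]
        have : A ^ (d - (i + 1)) * E * A ^ (j : ℕ) =
            (A ^ (d - (i + 1)) * E * A ^ ℓs) * D ℓs * A ^ ((j : ℕ) - ℓs) := by
          rw [Matrix.mul_assoc (A ^ (d - (i + 1))) E (A ^ (j : ℕ)), hfac]
          simp only [Matrix.mul_assoc]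
        rw [this]
        exact rank_mul_mul_le_mid _ _ _
      · -- the leaving path `A^{d-(i+1)}·E` from level `i+1` passes level `ℓs`
        have hi1 : i + 1 ≤ ℓs := by omega
        have hDd : D d * E = E := by rw [levelProj_mul_corner lvl D hD E hE d, if_pos rfl]
        have key : ∀ n : ℕ, i + 1 + ((ℓs - (i + 1)) + (d - ℓs)) = n →
            A ^ ((ℓs - (i + 1)) + (d - ℓs)) * D n = A ^ (ℓs - (i + 1)) * D ℓs * A ^ (d - ℓs) := by
          intro n hn
          subst hn
          rw [← intertwine_pow D A hcomm, proj_mul_pow_add D A hcomm,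
            show i + 1 + (ℓs - (i + 1)) = ℓs by omega]
        have : A ^ (d - (i + 1)) * E * A ^ (j : ℕ) =
            A ^ (ℓs - (i + 1)) * D ℓs * (A ^ (d - ℓs) * E * A ^ (j : ℕ)) := by
          conv_lhs => rw [← hDd, show d - (i + 1) = (ℓs - (i + 1)) + (d - ℓs) by omega]
          calc A ^ (ℓs - (i + 1) + (d - ℓs)) * (D d * E) * A ^ (j : ℕ)
              = (A ^ (ℓs - (i + 1) + (d - ℓs)) * D d) * E * A ^ (j : ℕ) := by
                simp only [Matrix.mul_assoc]
            _ = A ^ (ℓs - (i + 1)) * D ℓs * (A ^ (d - ℓs) * E * A ^ (j : ℕ)) := by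
                rw [key d (by omega)]; simp only [Matrix.mul_assoc]
        rw [this]
        exact rank_mul_mul_le_mid _ _ _
  -- receiving spaces
  have hX : Module.finrank K (LinearMap.range (D (i + 1)).mulVecLin) = Fintype.card {a // lvl a = i + 1} := by
    rw [finrank_range_mulVecLin, hD]; exact rank_diagonal_level lvl (i + 1)
  have hY : Module.finrank K (LinearMap.range (D i)ᵀ.mulVecLin) = Fintype.card {a // lvl a = i} := by
    rw [finrank_range_mulVecLin, Matrix.rank_transpose, hD]; exact rank_diagonal_level lvl i
  have main := finrank_span_mul_mul_le_of_antitone_monotone_of_le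
    (κ := fun _ : Fin d => ι) (μ := fun _ : Fin d => ι)
    (fun j : Fin d => D (i + 1) * (P * E * P) * D j) (fun j : Fin d => D ((j : ℕ) + 1) * P * D i)
    R C (LinearMap.range (D (i + 1)).mulVecLin) (LinearMap.range (D i)ᵀ.mulVecLin)
    hRX hCY hRanti hCmono hMmem hOmem ht
  rw [hX, hY] at main
  exact main

end Summit.ValiantsHypothesis.ValiantsHypothesis.Cruxes.TwoDimCoefficients.DimTwoCases

end
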